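import Literature.NumberTheory.EllipticCurves.BurungaleCastellaSkinner2025.BDPMainConjecture
import HarnessLib

/-!
# Castella–Çiperiani–Skinner–Sprung (arXiv:1804.10993v2, PREPRINT since 2018), §5.1 **Theorem 5.8** —
# the ANNOUNCED anticyclotomic Iwasawa–Greenberg (BDP) main conjecture
# `Ch_{Λ(Γ^ac)}(X^{rel,str}_{K_∞^ac}(f)) = (𝓛^BDP_𝔭(f/K)²)` in `Λ_ur(Γ^ac)`, with `Λ`-torsion, at an ODD
# prime of good NON-ORDINARY reduction split in `K` (so `p = 3`, `a_3 ∈ {0, ±3}` included), for `N`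
# square-free with a prime NON-SPLIT in `K` — as ONE explicitly labelled OPEN claim, plus the PROVED
# projections onto its two halves (the Wan direction `⊆` = display (5.7) of the printed proof, and the
# Howard direction `⊇`), in the frame currency of the sibling `AnticyclotomicHowardDivisibilityOPEN.lean`

HONEST FRAMING (cell `pub/bsd-wall`, arm-P typist `bsd-armP-typer-05`, fact F049
«CCSS18_thm58_wanDivisibility_apNonzero»). A PREPRINT's theorem enters the tree ONLY as an explicitly
labelled OPEN claim (`def … : Prop`, nothing asserted, no `_holds`, no `sorry`; D-0014) — the pattern
of this directory (`NonordinaryPPartOPEN.lean`: Thms. C/D; `AnticyclotomicHowardDivisibilityOPEN.lean`: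
Thm. 5.7 + Lemma 5.5, the `⊇` half under WEAKER hypotheses). Typed ≠ proved ≠ endorsed; BSD is not
advanced by this file. PREPRINT (unrefereed) — arXiv:1804.10993, v1 29 Apr 2018, v2 23 Aug 2018 (the
version read; arXiv listing GET 2026-08-29), no journal version (arXiv / zbMATH / Crossref cascade
2026-08-29; the sibling recorded the same on 2026-08-19). STATUS OF ITS INPUT: the `⊆` half of Thm. 5.8
is imported in print from Thm. 5.1, whose printed proof is "See part (2) of [Wan14b, Thm. 5.3]" =
X. Wan, arXiv:1411.6352 (2014) — a preprint "no longer intended for publication" (Burungale–Skinner–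
Tian–Wan, arXiv:2409.01350, Rem. 1.4 (i) `[corpus: paper:arxiv-2409.01350 p0004 L95–L99]`, whose
"pertinent parts … supersede the prior announcement"; BSTW's own supersingular results carry (h4)
"`a_p(E) = 0` if `p = 3`", tree `BurungaleSkinnerTianWan2024/GreenbergLFunctionSupersingularExistsPRE`).
Refereed neighbours (NOT this statement): Castella–Liu–Wan, FMS 10 (2022) e110, Thm. 8.2.1 (the
two-variable `⊆` over `Γ_K`, `p ≥ 3`, up to pullbacks of height-one primes of `Λ(Γ_K^+)`
`[corpus: paper:arxiv-2109.08375 p0055 L19–L45]`); its anticyclotomic descent Castella–Wan, Math. Ann.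
389 (2024) Thm. 5.3 at `p ≥ 5` (tree `CastellaWan2024.thm53_exists_isCWBDPLFunction_charIdeal_map_le`).
At `p = 3`, `a_3 = ±3` the statement below is in NO refereed print.

WHY (consumer by name): route `UniversalToricDescent`, child crux `TwinSplitIMCAtThreeGoodSS`
(stmt-BirchSwinnertonDyer-20695), line `threeframes` v4, stub `stub_wanFrameSS_apNonzero` (the
`a₃ = ±3` half of the rational Wan frame; bench seat 20695-wanFrameSSapNonzero: "requires CÇSS18
Thm 5.8 (Wan direction, ⊆) which is NOT typed in tree"). CONSUMER WARNING (printed hypothesis, not a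
choice of this file): Thm. 5.8 (like Thm. 5.1, [Wan14b], [CLW22] (ii), Castella–Wan Thm. 5.3 (ii))
REQUIRES "at least one prime `ℓ ∣ N` non-split in `K`" (with `ρ̄_f` ramified there). A field with the
CLASSICAL Heegner hypothesis in the tree's sense (`SatisfiesHeegnerHypothesis N K`: EVERY `ℓ ∣ N`
SPLIT) has no such prime, so that stub — whose `K` is all-split with `Odd (discr K)` — cannot be fed
`(h : thm58_…_OPEN)` as it stands; under (R2) below the non-split prime is a prime of `N` RAMIFIED in
`K` (Castella–Wan's "erratum-type" fields, MS p. 33: "if `N = q`, we consider `K` ramified at `q`").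

## Source, VERBATIM (arXiv:1804.10993v2, 33 pp.; PDF pages, cross-read on the held TeX text
## `paper:arxiv-1804.10993` = 27 chunks `pNNNN`)

* §4 standing (p. 17; chunk p0016 L3–L27): "Throughout this section, we let `f = Σ a_n q^n ∈
  S₂^new(Γ₀(N))` be a newform, and `p > 2` be a prime of good non-ordinary reduction for `f` as before.
  The imaginary quadratic field `K` (in which we continue to assume that `p = 𝔭𝔭̄` split) determines a
  factorization: • `N = N⁺N⁻` with `(N⁺,N⁻) = 1`, • `ℓ ∣ N⁺` if and only if `ℓ` is split or ramified in
  `K`, • `ℓ ∣ N⁻` if and only if `ℓ` is inert in `K`. We shall assume that `N⁻` is square-free, and say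
  that the pair `(f,K)` is indefinite (resp. definite) if `N⁻` is the product of an even (resp. odd)
  number of primes"; §4.1: "Let `X = X_{N⁺,N⁻}` be the Shimura curve (with the cusps added if `N⁻ = 1`)".
* Thm. 4.7 (p. 19; p0017 L116–L133): "There exists an element `𝓛^BDP_𝔭(f/K) ∈ Λ_ur(Γ^ac)` such that
  if `ψ : Γ^ac → ℂ_p^×` has trivial conductor and infinity type `(−m, m)` with `m > 0`, then
  `(ψ(𝓛^BDP_𝔭(f/K))/Ω_p^{2m})² = Γ(m)Γ(m+1)·(1 − p⁻¹ψ(𝔭)α)²(1 − p⁻¹ψ(𝔭)β)²·L(f/K,ψ,1)/(π^{2m+1}·Ω_K^{4m})`,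
  where `(Ω_p, Ω_K) ∈ ur^× × ℂ^×` are CM periods attached to `K`. Moreover, `𝓛_𝔭^BDP(f/K)` is
  nonzero, and if `ρ̄_f|_{G_K}` is absolutely irreducible, the `μ`-invariant of `𝓛_𝔭^BDP(f/K)` vanishes."
* Def. 2.10–2.11 (pp. 11–12; p0010 L69–p0011 L8): `Sel^{p}(K, 𝐌) = ker{H¹(𝔊_{K,Σ}, 𝐌) →
  ⊕_{v ∈ Σ∖{p}} H¹(K_v, 𝐌)}` (the "`p`-related strict Selmer group"); "`Sel^{rel,str}(K, 𝐌)` is the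
  submodule of `Sel^{p}(K, 𝐌)` consisting of classes which are trivial at `𝔭̄` (with no condition at
  `𝔭`)"; `X^𝓛_{K^ac_∞}(f)` = the Pontrjagin dual of the `𝐀^ac`-version, `𝐀^ac = 𝐓^ac ⊗ Λ(Γ^ac)^∨`,
  `𝐓^ac = T_f^* ⊗̂ Λ(Γ^ac)^ι` (p. 18) — the "strict analogues" `X` of the unramified-outside-`p`
  structures `𝔛`.
* Thm. 5.1 (p. 24; p0021 L6–L25): "Assume that: • `N` is square-free, • `ρ̄_f` is ramified at [some
  prime at] every prime `q ∣ N` which is nonsplit in `K`, and there is at least one such prime,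
  • `ρ̄_f|_{G_K}` is irreducible. Then we have the divisibility `Char_{Λ(Γ_K)}(𝔛^{rel,str}_{K_∞}(f))
  ⊆ (𝓛_𝔭(f/K))` as ideals in `Λ_{R₀}(Γ_K) ⊗_{ℤ_p} ℚ_p`, up to primes which are pullbacks for height
  one primes of `Λ(Γ_K^+)`. *Proof.* See part (2) of [Wan14b, Thm. 5.3]."
* Conj. 5.4 (p. 24; p0021 L97–L105): "The module `X^{rel,str}_{K_∞^ac}(f)` is `Λ(Γ^ac)`-torsion, and
  `Char_{Λ(Γ^ac)}(X^{rel,str}_{K_∞^ac}(f)) = (𝓛_𝔭^BDP(f/K)²)` as ideals in `Λ_ur(Γ^ac)`."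

> **Theorem 5.8** (p. 26; p0022 L101–L121). Let `f ∈ S₂(Γ₀(N))` be a newform, let `p ∤ N` be an odd
> prime, and let `K/ℚ` be an imaginary quadratic field in which `p = 𝔭𝔭̄` splits. Assume that `f` is
> non-ordinary at `p`, and that • `N` is square-free, • `N⁻` is divisible by an even number of
> primes, • `ρ̄_f` is ramified at every prime `ℓ ∣ N` which is nonsplit in `K`, and there is at least
> one such prime, • `ρ̄_f|_{G_K}` is irreducible. Then `X^{rel,str}_{K_∞^ac}(f)` is
> `Λ(Γ^ac)`-cotorsion, and `Ch_{Λ(Γ^ac)}(X^{rel,str}_{K_∞^ac}(f)) = (𝓛^BDP_𝔭(f/K)²)` as ideals in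
> `Λ_ur(Γ^ac)`. That is, under the stated hypotheses Conjecture 5.4 holds.

Printed proof (p. 27; p0023 L1–L28): "We shall adapt the arguments in [CW16] … From Theorem 5.7 and
Lemma 5.5, we know that … `𝔛^{rel,str}_{K_∞^ac}(f)` is `Λ(Γ^ac)`-torsion, and for any height one prime
`𝔓` of `Λ(Γ^ac)`, the inequalities (5.5) … and (5.6) `length_𝔓(𝔛^{rel,str}_{K_∞^ac}(f)) ⩽ 2 length_𝔓
(𝓛^BDP_𝔭(f/K))` hold. On the other hand, the divisibility in Theorem 5.1 combined with the comparison
of `p`-adic `L`-functions in [CW16, Cor. 1.12] and a standard control theorem (as in [SU14, Prop. 3.9]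
and [Wan14a, §3.2]) implies that **(5.7)** `Char_{Λ(Γ^ac)}(𝔛^{rel,str}_{K_∞^ac}(f)) ⊆ (𝓛^BDP_𝔭(f/K)²)`
as ideals in `Λ_ur(Γ^ac)`, using the fact that by the vanishing of the `μ`-invariant of `𝓛^BDP_𝔭(f/K)`
(see Theorem 4.7), the ambiguity by powers of `p` and pullbacks of height one primes of `Λ(Γ_K^+)` in
Theorem 5.1 can be removed. Now, (5.7) combined with (5.6) yields the equality in Conjecture 5.4 with
`𝔛^{rel,str}_{K_∞^ac}(f)` in place of `X^{rel,str}_{K_∞^ac}(f)`; since by [PW11, §3] (see also [Cas18,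
Prop. 2.5]) both Selmer modules have the same characteristic ideal under our ramification hypotheses
on `ρ̄_f`, the result follows." ("cotorsion" in the statement is the printed word for the dual module
`X`; the proof and Conj. 5.4 say "torsion" — typed as `Λ`-torsion of `X`.)

## TRANSCRIPTION (tree dictionary of the sibling `thm57_lemma55_…_OPEN` and of
## `BurungaleCastellaSkinner2025.thm124b_…_charIdeal_eq`; each restriction makes the claim WEAKER)

(R1) `f` = the newform of an elliptic curve `W/ℚ` (`IsNewformOf W f`, so `N = N_E`; `W` globally
minimal to read `a_p`), Hecke field `ℚ`. "`p ∤ N` odd, non-ordinary at `p`" = `p ≠ 2 ∧ GoodSS W p`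
(good, `p ∣ a_p`: at `p = 3` this INCLUDES `a_3 = ±3`, the paper's ♯/♭ setting, and `a_3 = 0`).
(R2) `N⁻ = 1`: EVERY prime `ℓ ∣ N` is split or ramified in `K`, spelled as in
`castella2018_exists_isBDPLFunction` (a prime of `K` of norm `ℓ`); then "`N⁻` is divisible by an even
number of primes" is vacuous (zero inert primes), `X_{N⁺,N⁻} = X₀(N)`, and "nonsplit" = RAMIFIED in
`K`. The classical all-split hypothesis `SatisfiesHeegnerHypothesis N K` is NOT used: it contradicts
the next binder. -- TODO(general form): `N⁻ ≠ 1` square-free indefinite (Shimura curves, `α(f,f_B)`).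
(R3) "`ρ̄_f` is ramified at every prime `ℓ ∣ N` which is nonsplit in `K`, and there is at least one
such prime": for an imaginary quadratic `K`, "`ℓ` nonsplit" = `#primesOver(ℓ) ≠ 2`; "`ρ̄_f = E[p]`
ramified at `ℓ`" for `ℓ ∥ N` (every `ℓ ∣ N`, `N` square-free) transcribed by Tate's parametrisation
EXACTLY as the tree's (ram)-at-`ℓ` (`Rank1Residual.Ram`'s body at a given `ℓ` =
`BurungaleSkinnerTianWan2024.RamAt W p ℓ`, definitionally; [SkinnerUrban2014, Thm. 2 second bullet]):
`ℓ ≠ p` of multiplicative reduction with `p ∤ ord_ℓ(Δ_min)` (the first two conjuncts are automatic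
here — `N = N_E` square-free, `p ∤ N` — so assuming them only weakens the claim).
(R4) `K` imaginary quadratic, (spl) as `#primesOver(p) = 2`, `v` the prime of the embedding datum `ι'`
(`k ∈ v ↔ ‖ι'⁻¹(k)‖_p < 1`), `vbar ∋ p` the other prime; (irr_K) `(W.baseChange K).HasIrreducibleModP…`;
`κ` anticyclotomic with topological generator `γ` (`1 + T ↔ γ`), `Λ(Γ^ac) = IwasawaAlgebra p`,
`Λ_ur(Γ^ac) = R₀⟦T⟧ = UnrSeries p` along THE structure map `j : ℤ_p → R₀` (`j(x) = x` in `ℂ_p`).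
(R5) `X^{rel,str}_{K_∞^ac}(f)` = `AcSelmer.XAc (W.baseChange K) p κ vbar ∅ γ` — Castella 2018 Def. 2.2
over `K_∞`: unrestricted above `v`, trivial above `vbar`, trivial (STRICT) at every `w ∤ p` (`Σ = ∅`),
which IS Def. 2.10–2.11's strict `Sel^{rel,str}(K, 𝐀^ac)` by Shapiro's lemma, strict at the prime
OPPOSITE to the frame's `v` (the sibling's and BCS's orientation, flags `BCS-124-XGr-reading`,
`CW24-53-orientation-L33`; Thm. 5.8 is about `X`, so the sibling's flag `CCSS18-frakX-reading` is NOT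
needed here). `(𝓛^BDP_𝔭)²` read through the frame predicate `IsBDPLFunction ι' v κ γ f Ω_K Ω_p L`
(Castella 2018 Thm. 3.1's normalisation: `((1 − p⁻¹ψ(𝔭)α)(1 − p⁻¹ψ(𝔭)β))² = (1 − a_p p⁻¹ψ(𝔭) +
p⁻¹ψ(𝔭)²)²` as `αβ = p`, `α + β = a_p`; "trivial conductor, infinity type `(−m, m)`, `m > 0`" = the
predicate's range), CM periods ∃-quantified with `Ω_K ≠ 0`, `Ω_p ∈ R₀ˣ` (not tree objects) — so the
conclusion "∃ frame with torsion and `Ch_Λ(X)·R₀⟦T⟧ = (L)`" is WEAKER than print, which pins `L`.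
NOT TYPED: Thm. 5.1 / Cor. 5.9 (two-variable `Γ_K`-objects), Thm. 5.7, Lemma 5.5 (sibling file), §5.2.

## Contents
* `thm58_exists_isBDPLFunction_isTorsion_charIdeal_map_eq_OPEN` — THE open claim (Thm. 5.8).
* PROVED bookkeeping (no content beyond the claim): `charIdeal_map_le_of_thm58_OPEN` (the Wan half
  `⊆`, display (5.7)); `wanFrame_of_thm58_OPEN` (the same in the "rational Wan frame" shape
  `∃ k, p^k · Ch ⊆ (L)` of the crux's stubs, `k = 0`, for a GIVEN structure map `j`);
  `mem_charIdeal_map_of_thm58_OPEN` (the Howard half `L ∈ Ch_Λ(X)·R₀⟦T⟧`).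

## References
* [CastellaCiperianiSkinnerSprung2018] arXiv:1804.10993v2 (23 Aug 2018): Thm. 5.8 (p. 26) and its
  proof with displays (5.5)–(5.7) (p. 27); Thm. 5.1, Conj. 5.4 (p. 24); Lemma 5.5 (p. 25); Thm. 5.7
  (p. 26); Cor. 5.9 (p. 27); §4 standing (p. 17); Thm. 4.7 (p. 19); Def. 2.10–2.11 (pp. 11–12).
* [BurungaleSkinnerTianWan2024] arXiv:2409.01350, Rem. 1.4 (i) (status of [Wan14b] = arXiv:1411.6352).
* [CastellaLiuWan2022] FMS 10 (2022) e110, Thm. 8.2.1; [CastellaWan2023] Math. Ann. 389 (2024) Thm. 5.3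
  (refereed neighbours); [Castella2018] Def. 2.2 (`AcSelmer.XAc`), Thm. 3.1 (`IsBDPLFunction`);
  [SkinnerUrban2014] Thm. 2 (the spelling of "ramified at `ℓ`"); [BurungaleCastellaSkinner2025]
  Thm. 1.2.4 (b) (the equality currency `charIdeal.map j = span {L}`).
-/

noncomputable section

open scoped Classical


namespace Literature.NumberTheory.EllipticCurves.CastellaCiperianiSkinnerSprung2018

open PowerSeries WeierstrassCurve NumberField IsDedekindDomain Field
  Literature.NumberTheory.EllipticCurves Literature.NumberTheory.EllipticCurves.ModularForms
  Literature.NumberTheory.QuadraticFields Literature.NumberTheory.EllipticCurves.Rank1Residual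
  Literature.NumberTheory.EllipticCurves.Castella2018

/-! ### §1 The open claim: Theorem 5.8 -/

/-- **OPEN CLAIM — UNREFEREED PREPRINT (Castella–Çiperiani–Skinner–Sprung, arXiv:1804.10993v2 of
23 Aug 2018; v1 29 Apr 2018; no journal version as of 2026-08-29), §5.1 Theorem 5.8 (p. 26; proof
p. 27)**, for the newform of an elliptic curve and `N⁻ = 1`. VERBATIM: "Let `f ∈ S₂(Γ₀(N))` be a
newform, let `p ∤ N` be an odd prime, and let `K/ℚ` be an imaginary quadratic field in which `p = 𝔭𝔭̄`
splits. Assume that `f` is non-ordinary at `p`, and that • `N` is square-free, • `N⁻` is divisible by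
an even number of primes, • `ρ̄_f` is ramified at every prime `ℓ ∣ N` which is nonsplit in `K`, and
there is at least one such prime, • `ρ̄_f|_{G_K}` is irreducible. Then `X^{rel,str}_{K_∞^ac}(f)` is
`Λ(Γ^ac)`-cotorsion, and `Ch_{Λ(Γ^ac)}(X^{rel,str}_{K_∞^ac}(f)) = (𝓛^BDP_𝔭(f/K)²)` as ideals in
`Λ_ur(Γ^ac)`. That is, under the stated hypotheses [statement 5.4] holds." Here (§4, p. 17) `N = N⁺N⁻`,
`ℓ ∣ N⁺` iff `ℓ` is split or ramified in `K`, `ℓ ∣ N⁻` iff `ℓ` is inert; (Def. 2.10–2.11, pp. 11–12)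
`X^{rel,str}_{K_∞^ac}(f)` is the Pontrjagin dual of the Selmer group of `𝐀^ac` with no condition at
`𝔭`, trivial at `𝔭̄`, strict at the places `v ∤ p`; (Thm. 4.7, p. 19) `𝓛^BDP_𝔭(f/K) ∈ Λ_ur(Γ^ac)` with
`(ψ(𝓛^BDP_𝔭)/Ω_p^{2m})² = Γ(m)Γ(m+1)(1 − p⁻¹ψ(𝔭)α)²(1 − p⁻¹ψ(𝔭)β)² L(f/K,ψ,1)/(π^{2m+1}Ω_K^{4m})` for
`ψ` of trivial conductor and infinity type `(−m, m)`, `m > 0`. TRANSCRIBED (module docstring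
(R1)–(R5), each WEAKER than print): `W/ℚ` globally minimal elliptic with newform `f` of level `N`;
`p ≠ 2`, `GoodSS W p` (good, `p ∣ a_p` — at `p = 3` both `a_3 = 0` and `a_3 = ±3`); `K` imaginary
quadratic; EVERY prime `ℓ ∣ N` split or ramified in `K` (`N⁻ = 1`, so the parity bullet is vacuous);
(spl) `#primesOver(p) = 2`; (irr_K); `v` the prime of the embedding datum `ι'`, `vbar ∋ p` the other
prime; `κ` anticyclotomic with topological generator `γ`; `Squarefree N`; (ram) at every `ℓ ∣ N`
NON-split in `K` (`#primesOver(ℓ) ≠ 2`), spelled as the tree's (ram)-at-`ℓ` "`ℓ ≠ p` multiplicative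
with `p ∤ ord_ℓ(Δ_min)`" (= `E[p]` ramified at `ℓ ∥ N`, Tate; = `BurungaleSkinnerTianWan2024.RamAt
W p ℓ`); and SOME prime `ℓ ∣ N` non-split in `K`. CONCLUSION: a frame `(Ω_K ≠ 0, Ω_p ∈ R₀ˣ, L)` with
`IsBDPLFunction ι' v κ γ f Ω_K Ω_p L` (`L` playing `(𝓛^BDP_𝔭)²`), `X := AcSelmer.XAc (W⁄K) p κ vbar
∅ γ` `Λ`-torsion, and along THE structure map `j : ℤ_p → R₀`, `Ch_Λ(X)·R₀⟦T⟧ = (L)`. WARNING: the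
binder "some `ℓ ∣ N` non-split" EXCLUDES every all-split field (`SatisfiesHeegnerHypothesis N K`);
at `N⁻ = 1` it is a prime of `N` RAMIFIED in `K`. STATUS: PRE — unrefereed; its `⊆` input Thm. 5.1 =
"[Wan14b, Thm. 5.3] part (2)" = arXiv:1411.6352 is "no longer intended for publication" (BSTW
arXiv:2409.01350 Rem. 1.4 (i)); refereed neighbours stop at `p ≥ 5` (Castella–Wan 2024 Thm. 5.3) or
two variables (Castella–Liu–Wan 2022 Thm. 8.2.1). NEVER cite this `Prop` as a theorem; take it as an
explicit hypothesis. -- TODO(general form): newforms with arbitrary Hecke field; `N⁻ ≠ 1`.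
[claim: CastellaCiperianiSkinnerSprung2018, status: under-review]
[cite: CastellaCiperianiSkinnerSprung2018, Thm. 5.8 (arXiv:1804.10993v2 §5.1, p. 26; proof p. 27, displays (5.5)–(5.7)); Thm. 5.1 and Conj. 5.4 (p. 24); §4 standing (p. 17); Thm. 4.7 (p. 19); Def. 2.10–2.11 (pp. 11–12)]
[cite: Castella2018, Def. 2.2 (the tree object `AcSelmer.XAc`), Thm. 3.1 (the normalisation `IsBDPLFunction`)]
[cite: SkinnerUrban2014, Thm. 2 (p. 3), second bullet (the spelling "`p ∤ ord_ℓ(Δ)`" of "ramified at `ℓ`")] -/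
def thm58_exists_isBDPLFunction_isTorsion_charIdeal_map_eq_OPEN : Prop :=
  ∀ {p : ℕ} [Fact p.Prime] (ι' : PadicAlgCl p ≃+* ℂ) (W : WeierstrassCurve ℚ) [W.IsElliptic]
    [W.IsGloballyMinimal] (K : Type) [Field K] [NumberField K] (v vbar : HeightOneSpectrum (𝓞 K))
    (κ : ZpExtension K p) (γ : absoluteGaloisGroup K) [Fact (κ.IsTopGenerator γ)] {N : ℕ} [NeZero N]
    {f : CuspForm (CongruenceSubgroup.Gamma0 N) 2} (_ : IsNewformOf W f),
    p ≠ 2 → GoodSS W p →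
    IsImaginaryQuadratic K →
      (∀ ℓ : ℕ, ℓ.Prime → ℓ ∣ N → ∃ w : HeightOneSpectrum (𝓞 K), Ideal.absNorm w.asIdeal = ℓ) →
      ((Ideal.span {(p : ℤ)}).primesOver (𝓞 K)).ncard = 2 →
      (W.baseChange K).HasIrreducibleModPGaloisRep p →
    (∀ (w : InfinitePlace K) (k : 𝓞 K), k ∈ v.asIdeal ↔ ‖ι'.symm (w.embedding (k : K))‖ < 1) →
      ((p : ℕ) : 𝓞 K) ∈ vbar.asIdeal → vbar ≠ v →
    κ.IsAnticyclotomic →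
    Squarefree N →
      (∀ ℓ : ℕ, ℓ.Prime → ℓ ∣ N → ((Ideal.span {(ℓ : ℤ)}).primesOver (𝓞 K)).ncard ≠ 2 →
        ∃ _ : Fact ℓ.Prime, ℓ ≠ p ∧ W.HasMultiplicativeReductionAtPrime ℓ ∧
          ¬ p ∣ padicValInt ℓ W.minimalDiscriminantInt) →
      (∃ ℓ : ℕ, ℓ.Prime ∧ ℓ ∣ N ∧ ((Ideal.span {(ℓ : ℤ)}).primesOver (𝓞 K)).ncard ≠ 2) →
    ∃ (ΩK : ℂ) (Ωp : (unrIntegers p)ˣ) (L : UnrSeries p),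
      ΩK ≠ 0 ∧ IsBDPLFunction ι' v κ γ f ΩK ((Ωp : unrIntegers p) : ℂ_[p]) L ∧
      Module.IsTorsion (IwasawaAlgebra p) (AcSelmer.XAc (W.baseChange K) p κ vbar ∅ γ) ∧
      ∀ (j : ℤ_[p] →+* unrIntegers p),
        (∀ x : ℤ_[p], ((j x : unrIntegers p) : ℂ_[p]) = algebraMap ℚ_[p] ℂ_[p] (x : ℚ_[p])) →
        (AcSelmer.XAc.charIdeal (W.baseChange K) p κ vbar ∅ γ).map (PowerSeries.map j) =
          Ideal.span {L}

/-! ### §2 Bookkeeping (PROVED): the two halves of the equality -/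

section Bookkeeping

variable {p : ℕ} [Fact p.Prime] (ι' : PadicAlgCl p ≃+* ℂ) (W : WeierstrassCurve ℚ) [W.IsElliptic]
  [W.IsGloballyMinimal] (K : Type) [Field K] [NumberField K] (v vbar : HeightOneSpectrum (𝓞 K))
  (κ : ZpExtension K p) (γ : absoluteGaloisGroup K) [Fact (κ.IsTopGenerator γ)] {N : ℕ} [NeZero N]
  {f : CuspForm (CongruenceSubgroup.Gamma0 N) 2}

/-- **The Wan half of Theorem 5.8 — display (5.7) of the printed proof (p. 27):
`Char_{Λ(Γ^ac)}(X^{rel,str}_{K_∞^ac}(f)) ⊆ (𝓛^BDP_𝔭(f/K)²)` in `Λ_ur(Γ^ac)`**, with `Λ`-torsion,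
GRANTED the open claim (projection of the equality; no content of its own). Hypotheses = those of
`thm58_…_OPEN`. [cite: CastellaCiperianiSkinnerSprung2018, proof of Thm. 5.8, display (5.7) (arXiv:1804.10993v2 p. 27)] -/
theorem charIdeal_map_le_of_thm58_OPEN
    (h : thm58_exists_isBDPLFunction_isTorsion_charIdeal_map_eq_OPEN) (hf : IsNewformOf W f)
    (hp : p ≠ 2) (hss : GoodSS W p) (hK : IsImaginaryQuadratic K)
    (hHeeg : ∀ ℓ : ℕ, ℓ.Prime → ℓ ∣ N → ∃ w : HeightOneSpectrum (𝓞 K), Ideal.absNorm w.asIdeal = ℓ)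
    (hspl : ((Ideal.span {(p : ℤ)}).primesOver (𝓞 K)).ncard = 2)
    (hirrK : (W.baseChange K).HasIrreducibleModPGaloisRep p)
    (hv : ∀ (w : InfinitePlace K) (k : 𝓞 K), k ∈ v.asIdeal ↔ ‖ι'.symm (w.embedding (k : K))‖ < 1)
    (hvbar : ((p : ℕ) : 𝓞 K) ∈ vbar.asIdeal) (hne : vbar ≠ v) (hκ : κ.IsAnticyclotomic)
    (hN : Squarefree N)
    (hram : ∀ ℓ : ℕ, ℓ.Prime → ℓ ∣ N → ((Ideal.span {(ℓ : ℤ)}).primesOver (𝓞 K)).ncard ≠ 2 →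
      ∃ _ : Fact ℓ.Prime, ℓ ≠ p ∧ W.HasMultiplicativeReductionAtPrime ℓ ∧
        ¬ p ∣ padicValInt ℓ W.minimalDiscriminantInt)
    (hns : ∃ ℓ : ℕ, ℓ.Prime ∧ ℓ ∣ N ∧ ((Ideal.span {(ℓ : ℤ)}).primesOver (𝓞 K)).ncard ≠ 2) :
    ∃ (ΩK : ℂ) (Ωp : (unrIntegers p)ˣ) (L : UnrSeries p),
      ΩK ≠ 0 ∧ IsBDPLFunction ι' v κ γ f ΩK ((Ωp : unrIntegers p) : ℂ_[p]) L ∧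
      Module.IsTorsion (IwasawaAlgebra p) (AcSelmer.XAc (W.baseChange K) p κ vbar ∅ γ) ∧
      ∀ (j : ℤ_[p] →+* unrIntegers p),
        (∀ x : ℤ_[p], ((j x : unrIntegers p) : ℂ_[p]) = algebraMap ℚ_[p] ℂ_[p] (x : ℚ_[p])) →
        (AcSelmer.XAc.charIdeal (W.baseChange K) p κ vbar ∅ γ).map (PowerSeries.map j) ≤
          Ideal.span {L} := by
  obtain ⟨ΩK, Ωp, L, hΩ, hL, htors, heq⟩ :=
    h ι' W K v vbar κ γ hf hp hss hK hHeeg hspl hirrK hv hvbar hne hκ hN hram hns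
  exact ⟨ΩK, Ωp, L, hΩ, hL, htors, fun j hj ↦ (heq j hj).le⟩

/-- **The Wan half of Theorem 5.8 in the "rational Wan frame" shape** of the crux stubs
(`∃ k, p^k · Ch_Λ(X)·R₀⟦T⟧ ⊆ (L)`, here with `k = 0`), for a GIVEN structure map `j : ℤ_p → R₀` and
with the `p`-adic period as a nonzero element of `ℂ_p`, GRANTED the open claim. Bookkeeping only.
[cite: CastellaCiperianiSkinnerSprung2018, proof of Thm. 5.8, display (5.7) (arXiv:1804.10993v2 p. 27)] -/
theorem wanFrame_of_thm58_OPEN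
    (h : thm58_exists_isBDPLFunction_isTorsion_charIdeal_map_eq_OPEN) (hf : IsNewformOf W f)
    (hp : p ≠ 2) (hss : GoodSS W p) (hK : IsImaginaryQuadratic K)
    (hHeeg : ∀ ℓ : ℕ, ℓ.Prime → ℓ ∣ N → ∃ w : HeightOneSpectrum (𝓞 K), Ideal.absNorm w.asIdeal = ℓ)
    (hspl : ((Ideal.span {(p : ℤ)}).primesOver (𝓞 K)).ncard = 2)
    (hirrK : (W.baseChange K).HasIrreducibleModPGaloisRep p)
    (hv : ∀ (w : InfinitePlace K) (k : 𝓞 K), k ∈ v.asIdeal ↔ ‖ι'.symm (w.embedding (k : K))‖ < 1)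
    (hvbar : ((p : ℕ) : 𝓞 K) ∈ vbar.asIdeal) (hne : vbar ≠ v) (hκ : κ.IsAnticyclotomic)
    (hN : Squarefree N)
    (hram : ∀ ℓ : ℕ, ℓ.Prime → ℓ ∣ N → ((Ideal.span {(ℓ : ℤ)}).primesOver (𝓞 K)).ncard ≠ 2 →
      ∃ _ : Fact ℓ.Prime, ℓ ≠ p ∧ W.HasMultiplicativeReductionAtPrime ℓ ∧
        ¬ p ∣ padicValInt ℓ W.minimalDiscriminantInt)
    (hns : ∃ ℓ : ℕ, ℓ.Prime ∧ ℓ ∣ N ∧ ((Ideal.span {(ℓ : ℤ)}).primesOver (𝓞 K)).ncard ≠ 2)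
    (j : ℤ_[p] →+* unrIntegers p)
    (hj : ∀ x : ℤ_[p], ((j x : unrIntegers p) : ℂ_[p]) = algebraMap ℚ_[p] ℂ_[p] (x : ℚ_[p])) :
    ∃ (ΩK : ℂ) (Ωp : ℂ_[p]) (L : UnrSeries p),
      ΩK ≠ 0 ∧ Ωp ≠ 0 ∧ IsBDPLFunction ι' v κ γ f ΩK Ωp L ∧
      ∃ k : ℕ, ∀ G ∈ (AcSelmer.XAc.charIdeal (W.baseChange K) p κ vbar ∅ γ).map (PowerSeries.map j),
        C ((p : unrIntegers p) ^ k) * G ∈ Ideal.span {L} := by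
  obtain ⟨ΩK, Ωp, L, hΩ, hL, -, heq⟩ :=
    h ι' W K v vbar κ γ hf hp hss hK hHeeg hspl hirrK hv hvbar hne hκ hN hram hns
  have hΩp : ((Ωp : unrIntegers p) : ℂ_[p]) ≠ 0 := by simp
  refine ⟨ΩK, ((Ωp : unrIntegers p) : ℂ_[p]), L, hΩ, hΩp, hL, 0, fun G hG ↦ ?_⟩
  rw [pow_zero, map_one, one_mul, ← heq j hj]
  exact hG

/-- **The Howard half of Theorem 5.8: `L ∈ Ch_Λ(X)·R₀⟦T⟧`** (the divisibility
`Ch_{Λ(Γ^ac)}(X^{rel,str}) ⊇ (𝓛^BDP_𝔭(f/K)²)`, displays (5.5)–(5.6) of the printed proof), with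
`Λ`-torsion, GRANTED the open claim — under Thm. 5.8's hypotheses; the sibling
`thm57_lemma55_exists_isBDPLFunction_isTorsion_mem_charIdeal_OPEN` states this half under the WEAKER
hypotheses of Thm. 5.7 at an all-split `K`. Bookkeeping only.
[cite: CastellaCiperianiSkinnerSprung2018, proof of Thm. 5.8, displays (5.5)–(5.6) (arXiv:1804.10993v2 p. 27)] -/
theorem mem_charIdeal_map_of_thm58_OPEN
    (h : thm58_exists_isBDPLFunction_isTorsion_charIdeal_map_eq_OPEN) (hf : IsNewformOf W f)
    (hp : p ≠ 2) (hss : GoodSS W p) (hK : IsImaginaryQuadratic K)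
    (hHeeg : ∀ ℓ : ℕ, ℓ.Prime → ℓ ∣ N → ∃ w : HeightOneSpectrum (𝓞 K), Ideal.absNorm w.asIdeal = ℓ)
    (hspl : ((Ideal.span {(p : ℤ)}).primesOver (𝓞 K)).ncard = 2)
    (hirrK : (W.baseChange K).HasIrreducibleModPGaloisRep p)
    (hv : ∀ (w : InfinitePlace K) (k : 𝓞 K), k ∈ v.asIdeal ↔ ‖ι'.symm (w.embedding (k : K))‖ < 1)
    (hvbar : ((p : ℕ) : 𝓞 K) ∈ vbar.asIdeal) (hne : vbar ≠ v) (hκ : κ.IsAnticyclotomic)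
    (hN : Squarefree N)
    (hram : ∀ ℓ : ℕ, ℓ.Prime → ℓ ∣ N → ((Ideal.span {(ℓ : ℤ)}).primesOver (𝓞 K)).ncard ≠ 2 →
      ∃ _ : Fact ℓ.Prime, ℓ ≠ p ∧ W.HasMultiplicativeReductionAtPrime ℓ ∧
        ¬ p ∣ padicValInt ℓ W.minimalDiscriminantInt)
    (hns : ∃ ℓ : ℕ, ℓ.Prime ∧ ℓ ∣ N ∧ ((Ideal.span {(ℓ : ℤ)}).primesOver (𝓞 K)).ncard ≠ 2) :
    ∃ (ΩK : ℂ) (Ωp : (unrIntegers p)ˣ) (L : UnrSeries p),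
      ΩK ≠ 0 ∧ IsBDPLFunction ι' v κ γ f ΩK ((Ωp : unrIntegers p) : ℂ_[p]) L ∧
      Module.IsTorsion (IwasawaAlgebra p) (AcSelmer.XAc (W.baseChange K) p κ vbar ∅ γ) ∧
      ∀ (j : ℤ_[p] →+* unrIntegers p),
        (∀ x : ℤ_[p], ((j x : unrIntegers p) : ℂ_[p]) = algebraMap ℚ_[p] ℂ_[p] (x : ℚ_[p])) →
        L ∈ (AcSelmer.XAc.charIdeal (W.baseChange K) p κ vbar ∅ γ).map (PowerSeries.map j) := by
  obtain ⟨ΩK, Ωp, L, hΩ, hL, htors, heq⟩ :=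
    h ι' W K v vbar κ γ hf hp hss hK hHeeg hspl hirrK hv hvbar hne hκ hN hram hns
  refine ⟨ΩK, Ωp, L, hΩ, hL, htors, fun j hj ↦ ?_⟩
  rw [heq j hj]
  exact Ideal.mem_span_singleton_self L

end Bookkeeping

end Literature.NumberTheory.EllipticCurves.CastellaCiperianiSkinnerSprung2018

end
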